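import Mathlib.Analysis.SpecialFunctions.Pow.Real
import Mathlib.Analysis.SpecialFunctions.Exp
import Mathlib.Analysis.SpecialFunctions.Log.Basic
import HarnessLib

/-!
# Elementary real inequalities for the RST parameters (Lemma 13-type algebra)

B. Rossman, R. A. Servedio, L.-Y. Tan, *An average-case depth hierarchy theorem for Boolean
circuits*, arXiv:1504.03398 [RossmanServedioTan2015], §10.1 Lemma 13 (p. 32–33): for a typical
`τ` and `|S| = qw ± Δ`, the star probability `q_a = ((1-t_k)^{|S|} - λ)/t_{k-1}` of a block is
`q (1 ± O(t_k Δ))`, by the defining identity `(1-t_k)^{qw} = λ + q t_{k-1}` (eq. (11)).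

This file isolates the real-variable algebra (no process objects): bounds on `(1-t)^{±Δ}`
(`one_sub_pow_window`), the two-sided window for `q_a` (`qa_window`), the bound `(1-t)^{|S|} ≤ 4p`
(`mass_le`) and the resulting projection-switching-lemma side conditions (`psl_conditions`) for
`Γ = λ/(16 q³)`. Constants are generous.
-/

noncomputable section

namespace Literature.Computability.Complexity

namespace RSTProj

open Real

/-- `(1-t)^{-Δ} ≤ 1 + 4tΔ` and `1 - 2tΔ ≤ (1-t)^{Δ}` for `0 ≤ t ≤ 1/2`, `0 ≤ Δ`, `2tΔ ≤ 1/4`; hence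
`(1-t)^δ ∈ [1 - 4tΔ, 1 + 4tΔ]` for `|δ| ≤ Δ`. [cite: RossmanServedioTan2015, §10.1 proof of Lemma 13 (p. 33, `(1-t_k)^{w^β} ≥ 1 - t_k w^β`, `(1-t_k)^{-w^β} ≤ 1 + 2 t_k w^β`)] -/
theorem one_sub_rpow_window {t Δ δ : ℝ} (ht0 : 0 ≤ t) (ht2 : t ≤ 1 / 2) (hΔ : 0 ≤ Δ) (htΔ : 2 * t * Δ ≤ 1 / 4)
    (hδ : |δ| ≤ Δ) : 1 - 4 * t * Δ ≤ (1 - t) ^ δ ∧ (1 - t) ^ δ ≤ 1 + 4 * t * Δ := by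
  have hb0 : 0 < 1 - t := by linarith
  have hb1 : 1 - t ≤ 1 := by linarith
  -- Bernoulli: `(1-t)^Δ ≥ 1 - tΔ/(1-t) ≥ 1 - 2tΔ`
  have hlow : 1 - 2 * t * Δ ≤ (1 - t) ^ Δ := by
    have h1 : Real.exp (-(t / (1 - t)) * Δ) ≤ (1 - t) ^ Δ := by
      rw [Real.rpow_def_of_pos hb0]
      apply Real.exp_le_exp.2
      apply mul_le_mul_of_nonneg_right _ hΔ
      -- `-(t/(1-t)) ≤ log (1-t)` from `log x ≥ 1 - 1/x`
      have := Real.one_sub_inv_le_log_of_pos hb0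
      rw [neg_le]
      calc -Real.log (1 - t) ≤ (1 - t)⁻¹ - 1 := by linarith
        _ = t / (1 - t) := by field_simp; ring
    have h2 : 1 + -(t / (1 - t)) * Δ ≤ Real.exp (-(t / (1 - t)) * Δ) := Real.add_one_le_exp _ |>.trans' (by linarith)
    have h3 : t / (1 - t) * Δ ≤ 2 * t * Δ := by
      apply mul_le_mul_of_nonneg_right _ hΔ
      rw [div_le_iff₀ hb0]; nlinarith
    linarith
  have habsδ := abs_le.1 hδ
  constructor
  · -- lower: `(1-t)^δ ≥ (1-t)^Δ ≥ 1 - 2tΔ ≥ 1 - 4tΔ`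
    calc 1 - 4 * t * Δ ≤ 1 - 2 * t * Δ := by nlinarith
      _ ≤ (1 - t) ^ Δ := hlow
      _ ≤ (1 - t) ^ δ := Real.rpow_le_rpow_of_exponent_ge hb0 hb1 habsδ.2
  · -- upper: `(1-t)^δ ≤ (1-t)^{-Δ} = 1/(1-t)^Δ ≤ 1/(1 - 2tΔ) ≤ 1 + 4tΔ`
    have hpos : 0 < 1 - 2 * t * Δ := by linarith
    calc (1 - t) ^ δ ≤ (1 - t) ^ (-Δ) := Real.rpow_le_rpow_of_exponent_ge hb0 hb1 (by linarith)
      _ = ((1 - t) ^ Δ)⁻¹ := Real.rpow_neg hb0.le Δ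
      _ ≤ (1 - 2 * t * Δ)⁻¹ := by
          rw [inv_le_inv₀ (Real.rpow_pos_of_pos hb0 Δ) hpos]; exact hlow
      _ ≤ 1 + 4 * t * Δ := by
          rw [inv_eq_one_div, div_le_iff₀ hpos]
          have hx : 0 ≤ t * Δ := mul_nonneg ht0 hΔ
          nlinarith [mul_nonneg hx (by linarith : (0 : ℝ) ≤ 1 - 4 * t * Δ)]

/-- **Lemma 13 (algebra).** With `u = (1-t)^δ`, `|δ| ≤ Δ`, and `X = (λ + q t') u` (this is
`(1-t_k)^{|S|}` for `|S| = qw + δ` by eq. (11)), the star probability `q_a = (X - λ)/t'` satisfies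
`|q_a - q| ≤ 16 q² Δ`, and `0 ≤ X ≤ 4 q²` — for `0 < t ≤ min(2q, 1/2)`, `t' ≥ q/2`, `0 ≤ λ ≤ q²/2`,
`2tΔ ≤ 1/4`. [cite: RossmanServedioTan2015, §10.1 Lemma 13 (pp. 32–33)] -/
theorem qa_window {q t t' lam Δ δ : ℝ} (hq : 0 < q) (ht0 : 0 ≤ t) (ht2q : t ≤ 2 * q) (ht2 : t ≤ 1 / 2)
    (ht' : q / 2 ≤ t') (ht'2 : t' ≤ 2 * q) (hlam0 : 0 ≤ lam) (hlam : lam ≤ q ^ 2 / 2) (hΔ : 0 ≤ Δ)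
    (htΔ : 2 * t * Δ ≤ 1 / 4) (hδ : |δ| ≤ Δ) :
    |((lam + q * t') * (1 - t) ^ δ - lam) / t' - q| ≤ 16 * q ^ 2 * Δ ∧
      0 ≤ (lam + q * t') * (1 - t) ^ δ ∧ (lam + q * t') * (1 - t) ^ δ ≤ 4 * q ^ 2 := by
  obtain ⟨hu1, hu2⟩ := one_sub_rpow_window ht0 ht2 hΔ htΔ hδ
  set u := (1 - t) ^ δ with hu
  have ht'0 : 0 < t' := by linarith
  have hu0 : 0 ≤ u := by rw [hu]; exact Real.rpow_nonneg (by linarith) δ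
  have habs : |u - 1| ≤ 8 * q * Δ := by
    rw [abs_le]; constructor <;> nlinarith
  refine ⟨?_, mul_nonneg (by positivity) hu0, ?_⟩
  · -- `q_a - q = q (u - 1) + λ (u - 1)/t'`
    have e : ((lam + q * t') * u - lam) / t' - q = (q + lam / t') * (u - 1) := by
      field_simp; ring
    rw [e, abs_mul]
    have hcoef : |q + lam / t'| ≤ 2 * q := by
      rw [abs_of_nonneg (by positivity)]
      have : lam / t' ≤ q := by
        rw [div_le_iff₀ ht'0]; nlinarith
      linarith
    calc |q + lam / t'| * |u - 1| ≤ 2 * q * (8 * q * Δ) :=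
          mul_le_mul hcoef habs (abs_nonneg _) (by positivity)
      _ = 16 * q ^ 2 * Δ := by ring
  · -- `X ≤ (λ + q t') (1 + 4tΔ) ≤ (q²/2 + 2 q²) · 3/2 ≤ 4 q²`
    have h1 : (lam + q * t') * u ≤ (lam + q * t') * (3 / 2) :=
      mul_le_mul_of_nonneg_left (by linarith) (by positivity)
    nlinarith [mul_le_mul_of_nonneg_left ht'2 hq.le]

/-- **The side conditions of the projection switching lemma** (`psl_level`) for `Γ = λ/(16 q³)`:
if `q_a ∈ [q/2, 2q]`, `0 ≤ X ≤ 4 q²` (`X = (1-t)^{|S|}`), `0 < λ ≤ q²/2`, `q ≤ 1/16`, then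
`0 < q_a ≤ 1 - λ`, `Γ q_a ≤ 1 - λ - q_a` and `Γ q_a X ≤ λ (1 - X)`. [cite: RossmanServedioTan2015, §10.1 Prop. 12 (p. 34, the choice `Γ = λ/(8q³)`) with Lemma 7.5 (p. 20)] -/
theorem psl_conditions {q lam qa X : ℝ} (hq : 0 < q) (hq16 : q ≤ 1 / 16) (hlam0 : 0 < lam) (hlam : lam ≤ q ^ 2 / 2)
    (hqa1 : q / 2 ≤ qa) (hqa2 : qa ≤ 2 * q) (hX0 : 0 ≤ X) (hX : X ≤ 4 * q ^ 2) :
    0 < qa ∧ qa ≤ 1 - lam ∧ lam / (16 * q ^ 3) * qa ≤ 1 - lam - qa ∧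
      lam / (16 * q ^ 3) * qa * X ≤ lam * (1 - X) := by
  have hq2 : q ^ 2 ≤ q / 16 := by nlinarith
  have hΓqa : lam / (16 * q ^ 3) * qa ≤ 1 / 16 := by
    rw [div_mul_eq_mul_div, div_le_iff₀ (by positivity)]
    nlinarith [mul_le_mul hlam hqa2 (by linarith) (by positivity)]
  refine ⟨by linarith, by nlinarith, by nlinarith, ?_⟩
  -- `Γ q_a X ≤ (λ/(16q³)) · 2q · 4q² = λ/2 ≤ λ (1 - X)` as `X ≤ 1/2`
  have hX2 : X ≤ 1 / 2 := by nlinarith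
  have hΓ0 : 0 ≤ lam / (16 * q ^ 3) := by positivity
  have h1 : lam / (16 * q ^ 3) * qa * X ≤ lam / (16 * q ^ 3) * (2 * q) * (4 * q ^ 2) :=
    mul_le_mul (mul_le_mul_of_nonneg_left hqa2 hΓ0) hX hX0 (by positivity)
  have e : lam / (16 * q ^ 3) * (2 * q) * (4 * q ^ 2) = lam / 2 := by
    field_simp; ring
  rw [e] at h1
  nlinarith

end RSTProj

end Literature.Computability.Complexity

end
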